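import Summits.CriticalPhenomena.PercolationContinuityZ3.Theorems.PercNearOneGluingNoHeavyConstsMDLXJointXEdgeInduction
import HarnessLib

/-!
# CROSS at the reach marker `u = z`, marker-pinned class: `M₂ ≥ 0` on `{U ⊆ {s↔y}}` from three exchange inequalities
# (PAPER-2 track (ii), seat `prim-consts-2`, gen 21)

builds on p205010 (kernel theorem, internal audit signed; external expert review pending).  Support file (`--supports
stmt-CriticalPhenomena-4575`); theorems only, no sorries, standard axioms.  Memos `run/shared/lean/prim/consts/FROM-prim-consts-2-g19-RIDER-EXCHANGE.md`
§0(3d), §5 (blueprint) and `FROM-prim-consts-2-g21-GIBBS-ORBIT.md`.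

Notation of the MDL(X)′ programme (`Consts.MDLXJoint`, `Consts.polMargin`, `Consts.CrossRel`): owner `s`, avoided set `X`, markers `y`, `z`;
`D = {s ↮ X}`, `D' = {s ↮ X ∪ {z}} = D ∖ Z`, `Y = {s ↔ y}`, `Z = {s ↔ z}`, `W = {y ↔ z}`, `N = D ∖ Y`, `T = {y ↮ {s} ∪ X} ∩ D`,
`T' = {y ↮ {s,z} ∪ X} ∩ D'`, `E₁ = {{s,y} ↮ X}`, `Q = {y ↔ X}`.  The CROSS member `M₂` of `Consts.CrossRel` at the added vertex `u = z` is
`R2z(F) = μ(T')·cov_D(F;Z) − μ(T∩W)·cov_{D'}(F;Y)`; `…ConstsCrossReach.lean` proves both members `≥ 0` on the reach-pinned classes `U ⊆ Z`,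
`U ⊇ Z`.  THIS FILE: the MARKER-pinned class — `F` reads `1{V(C_s) ∈ 𝒰}` on the clusters, `𝒰` a monotone family of vertex sets all containing
`y` (every increasing event of the vertex cluster of `s` inside `{s ↔ y}`).  For such `F` the member is, EXACTLY (a `ring` identity in nine atoms
after fifteen two-block splits of `D`; found by the seat's LP over exchange/CPA generators, memo g19 §0(3d), re-verified exactly gen 21):
  `R2z = μ(T∩W)·G₁ + μ(T')·G₂ + μ(N∩Q∖Z)·G₃ + μ(D'∩Y∩U)·G₅ + μ(D'∩Y∩U)·μ(T∩W)·μ(N∩Q∩Z)`,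
  `G₁ = μ(T∖Z)·μ(D∩Y∩U∩Z) − μ(D∩Y∩U)·μ(T∩W)`,  `G₂ = μ(E₁)·μ(D∩Y∩U∩Z) − μ(E₁∩{z ∈ C_s∪C_y})·μ(D∩Y∩U)`,
  `G₃ = μ(T)·μ(D∩Y∩U∩Z) − μ(T∩{z ∈ C_s∪C_y})·μ(D∩Y∩U)`,  `G₅ = μ(T∩Z)·μ(N) − μ(N∩Z)·μ(T)`.
`G₅ ≥ 0` is van den Berg–Häggström–Kahn's Theorem 1.4 with sets (`{s}` versus `{y} ∪ X`: `1{s↔z}` and `1{y↔X}` are negatively correlated given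
`s ↮ {y} ∪ X`), proved here; `G₁, G₂, G₃ ≥ 0` are "exchange" inequalities for the source set `{s,y}` — instances of the tree's
`Consts.localEv_fourEvents` (Ahlswede–Daykin four events under avoidance conditioning), proved in the companion file
`…ConstsCrossReachMarkerPinnedExchanges.lean` and taken HERE AS HYPOTHESES `hG1 hG2 hG3` (that file's module `…ConstsSourceLocalFourEvents`
was not yet built on the farm when this one was checked).
* `Consts.crossRel_reach_M2_of_markerPinned_of_exchanges` — **THEOREM: `hG1 ∧ hG2 ∧ hG3 ⟹ P(X',X',X) + P(X',X,X') + P(X,X',X') ≥ 0`** (`X' = X ∪ {z}`,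
  `P = Consts.polMargin`) for every weighted graph, all `s, y, z, X`, every monotone `𝒰` with `𝒰 S → y ∈ S` and every `F` with
  `F(C_s(ω)) = 1{𝒰 {v | s ↔ v}}`.
Numerics (exact, this seat): identity 0/400 failures; `G₁, G₂, G₃, G₅ ≥ 0` in every instance; `Consts.CrossRel` 0 violations in ≈ 2·10⁶ corner-weight instances.
[cite: VandenbergHaggstromKahn2005, Thm. 1.4 (p. 7) with Remark 1 after Thm. 1.2 (p. 5); Thm. 1.1 (pp. 3–5)]
-/

noncomputable section

namespace Summit.CriticalPhenomena.PercolationContinuityZ3.Theorems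

open MeasureTheory Set Literature.Probability.LatticeModels Literature.Probability.Percolation
open scoped Classical

namespace Consts

variable {V : Type*} [Fintype V]

omit [Fintype V] in
/-- With `u = z`: `{s ↮ X ∪ {z}} = {s ↮ X} ∖ {s ↔ z}` (as in `…ConstsCrossReach.lean`). [folklore] -/
private theorem avoid_insert_eq_diff' (s z : V) (X : Set V) :
    {ω : BondConfig V | ∀ x ∈ insert z X, ¬ (openGraph ω).Reachable s x} =
      {ω : BondConfig V | ∀ x ∈ X, ¬ (openGraph ω).Reachable s x} \ openConn s z := by
  ext ω
  simp only [mem_setOf_eq, forall_mem_insert, mem_sdiff, openConn]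
  tauto

omit [Fintype V] in
/-- With `u = z`: the copy-0 event of the `X ∪ {z}`-slot is disjoint from `{y ↔ z}` (as in `…ConstsCrossReach.lean`). [folklore] -/
private theorem avoidY_insert_inter_conn_eq_empty' (s y z : V) (X : Set V) (S : Set (BondConfig V)) :
    {ω : BondConfig V | ∀ x ∈ insert s (insert z X), ¬ (openGraph ω).Reachable y x} ∩ S ∩ openConn y z = ∅ := by
  refine Set.eq_empty_of_forall_notMem fun ω hω => ?_
  exact hω.1.1 z (mem_insert_of_mem s (mem_insert z X)) hω.2

omit [Fintype V] in
/-- The nine-atom algebra of the marker-pinned class: with the two-block splits of the module docstring substituted, the member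
`t'(d'·b − aZ·dz) − tw(d'·aZ − aZ·dy')` is the announced nonnegative combination. [folklore] -/
theorem markerPinned_algebra (b aZ yZu yzu TZ tw tp q1 Q23 : ℝ) :
    tp * ((aZ + yzu + tw + tp + Q23) * b - aZ * (b + yZu + TZ + q1)) -
        tw * ((aZ + yzu + tw + tp + Q23) * aZ - aZ * (aZ + yzu)) =
      tw * ((tw + tp) * b - (b + aZ) * tw) +
        tp * ((b + aZ + yZu + yzu + TZ + tw + tp) * b - (b + yZu + TZ + tw) * (b + aZ)) +
        Q23 * ((TZ + tw + tp) * b - (TZ + tw) * (b + aZ)) +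
        aZ * (TZ * (TZ + tw + tp + q1 + Q23) - (TZ + q1) * (TZ + tw + tp)) +
        aZ * tw * q1 := by
  ring

/-- **CROSS member `M₂` at `u = z` on the marker-pinned class, from the three exchange inequalities.**  See the module docstring:
`hG1`, `hG2`, `hG3` are the exchange inequalities `G₁, G₂, G₃ ≥ 0` (product form); `G₅ ≥ 0` (BHK Thm 1.4 with sets) is proved inside.
[cite: VandenbergHaggstromKahn2005, Thm. 1.4 (p. 7) with Remark 1 after Thm. 1.2 (p. 5)] -/
theorem crossRel_reach_M2_of_markerPinned_of_exchanges (w : Sym2 V → unitInterval) (s y z : V) (X : Set V)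
    {𝒰 : Set V → Prop} (h𝒰y : ∀ S : Set V, 𝒰 S → y ∈ S)
    (F : Set (Sym2 V) → ℝ) (hF : ∀ ω : BondConfig V, F (openEdgeCluster ω s) = if 𝒰 {v | (openGraph ω).Reachable s v} then 1 else 0)
    (hG1 : (prodBernoulli w).real ({ω : BondConfig V | ∀ x ∈ X, ¬ (openGraph ω).Reachable s x} ∩ openConn s y ∩
            {ω | 𝒰 {v | (openGraph ω).Reachable s v}}) *
        (prodBernoulli w).real ({ω : BondConfig V | ∀ x ∈ insert s X, ¬ (openGraph ω).Reachable y x} ∩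
            {ω | ∀ x ∈ X, ¬ (openGraph ω).Reachable s x} ∩ openConn y z) ≤
      (prodBernoulli w).real (({ω : BondConfig V | ∀ x ∈ insert s X, ¬ (openGraph ω).Reachable y x} ∩
            {ω | ∀ x ∈ X, ¬ (openGraph ω).Reachable s x}) \ openConn s z) *
        (prodBernoulli w).real ({ω : BondConfig V | ∀ x ∈ X, ¬ (openGraph ω).Reachable s x} ∩ openConn s y ∩
            {ω | 𝒰 {v | (openGraph ω).Reachable s v}} ∩ openConn s z))
    (hG2 : (prodBernoulli w).real ({ω : BondConfig V | ∀ x ∈ X, ¬ (openGraph ω).Reachable y x} ∩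
            {ω | ∀ x ∈ X, ¬ (openGraph ω).Reachable s x} ∩ (openConn s z ∪ openConn y z)) *
        (prodBernoulli w).real ({ω : BondConfig V | ∀ x ∈ X, ¬ (openGraph ω).Reachable s x} ∩ openConn s y ∩
            {ω | 𝒰 {v | (openGraph ω).Reachable s v}}) ≤
      (prodBernoulli w).real ({ω : BondConfig V | ∀ x ∈ X, ¬ (openGraph ω).Reachable y x} ∩
            {ω | ∀ x ∈ X, ¬ (openGraph ω).Reachable s x}) *
        (prodBernoulli w).real ({ω : BondConfig V | ∀ x ∈ X, ¬ (openGraph ω).Reachable s x} ∩ openConn s y ∩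
            {ω | 𝒰 {v | (openGraph ω).Reachable s v}} ∩ openConn s z))
    (hG3 : (prodBernoulli w).real ({ω : BondConfig V | ∀ x ∈ insert s X, ¬ (openGraph ω).Reachable y x} ∩
            {ω | ∀ x ∈ X, ¬ (openGraph ω).Reachable s x} ∩ (openConn s z ∪ openConn y z)) *
        (prodBernoulli w).real ({ω : BondConfig V | ∀ x ∈ X, ¬ (openGraph ω).Reachable s x} ∩ openConn s y ∩
            {ω | 𝒰 {v | (openGraph ω).Reachable s v}}) ≤
      (prodBernoulli w).real ({ω : BondConfig V | ∀ x ∈ insert s X, ¬ (openGraph ω).Reachable y x} ∩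
            {ω | ∀ x ∈ X, ¬ (openGraph ω).Reachable s x}) *
        (prodBernoulli w).real ({ω : BondConfig V | ∀ x ∈ X, ¬ (openGraph ω).Reachable s x} ∩ openConn s y ∩
            {ω | 𝒰 {v | (openGraph ω).Reachable s v}} ∩ openConn s z)) :
    0 ≤ polMargin (prodBernoulli w) s y z F (insert z X) (insert z X) X +
          polMargin (prodBernoulli w) s y z F (insert z X) X (insert z X) +
        polMargin (prodBernoulli w) s y z F X (insert z X) (insert z X) := by
  classical
  set μ := prodBernoulli w with hμ
  -- degenerate case `z = s`
  by_cases hzs : z = s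
  · subst hzs
    have h0 : ∀ X₁ X₂ : Set V, polMargin μ z y z F (insert z X) X₁ X₂ = 0 := fun X₁ X₂ =>
      polMargin_eq_zero_of_slot0 μ z y z F _ X₁ X₂ (Or.inl (mem_insert z X))
    have h2 : ∀ X₀ X₁ : Set V, polMargin μ z y z F X₀ X₁ (insert z X) = 0 := fun X₀ X₁ =>
      polMargin_eq_zero_of_slot2 μ z y z F X₀ X₁ _ (mem_insert z X)
    rw [h0, h0, h2]; norm_num
  have hmeas : ∀ S : Set (BondConfig V), MeasurableSet S := fun _ => MeasurableSet.of_discrete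
  -- the events
  set D : Set (BondConfig V) := {ω | ∀ x ∈ X, ¬ (openGraph ω).Reachable s x} with hD
  set D' : Set (BondConfig V) := {ω | ∀ x ∈ insert z X, ¬ (openGraph ω).Reachable s x} with hD'
  set A : Set (BondConfig V) := {ω | ∀ x ∈ insert s X, ¬ (openGraph ω).Reachable y x} with hA
  set A' : Set (BondConfig V) := {ω | ∀ x ∈ insert s (insert z X), ¬ (openGraph ω).Reachable y x} with hA'
  set A₀ : Set (BondConfig V) := {ω | ∀ x ∈ X, ¬ (openGraph ω).Reachable y x} with hA₀
  set Yv : Set (BondConfig V) := openConn s y with hYv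
  set Zv : Set (BondConfig V) := openConn s z with hZv
  set Wv : Set (BondConfig V) := openConn y z with hWv
  set U : Set (BondConfig V) := {ω | 𝒰 {v | (openGraph ω).Reachable s v}} with hU
  set Gy : Set (BondConfig V) := {ω | ∃ x ∈ X, (openGraph ω).Reachable y x} with hGy
  set N : Set (BondConfig V) := {ω | ∀ a ∈ ({s} : Set V), ∀ t ∈ insert y X, ¬ (openGraph ω).Reachable a t} with hN
  -- membership lemmas
  have mD : ∀ ω, ω ∈ D ↔ ∀ x ∈ X, ¬ (openGraph ω).Reachable s x := fun ω => Iff.rfl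
  have mD' : ∀ ω, ω ∈ D' ↔ ¬ (openGraph ω).Reachable s z ∧ ∀ x ∈ X, ¬ (openGraph ω).Reachable s x := fun ω => by
    simp only [hD', mem_setOf_eq, forall_mem_insert]
  have mA : ∀ ω, ω ∈ A ↔ ¬ (openGraph ω).Reachable y s ∧ ∀ x ∈ X, ¬ (openGraph ω).Reachable y x := fun ω => by
    simp only [hA, mem_setOf_eq, forall_mem_insert]
  have mA' : ∀ ω, ω ∈ A' ↔ ¬ (openGraph ω).Reachable y s ∧ ¬ (openGraph ω).Reachable y z ∧
      ∀ x ∈ X, ¬ (openGraph ω).Reachable y x := fun ω => by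
    simp only [hA', mem_setOf_eq, forall_mem_insert]
  have mA₀ : ∀ ω, ω ∈ A₀ ↔ ∀ x ∈ X, ¬ (openGraph ω).Reachable y x := fun ω => Iff.rfl
  have mY : ∀ ω, ω ∈ Yv ↔ (openGraph ω).Reachable s y := fun ω => Iff.rfl
  have mZ : ∀ ω, ω ∈ Zv ↔ (openGraph ω).Reachable s z := fun ω => Iff.rfl
  have mW : ∀ ω, ω ∈ Wv ↔ (openGraph ω).Reachable y z := fun ω => Iff.rfl
  have mU : ∀ ω, ω ∈ U ↔ 𝒰 {v | (openGraph ω).Reachable s v} := fun ω => Iff.rfl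
  have mGy : ∀ ω, ω ∈ Gy ↔ ∃ x ∈ X, (openGraph ω).Reachable y x := fun ω => Iff.rfl
  have mN : ∀ ω, ω ∈ N ↔ ¬ (openGraph ω).Reachable s y ∧ ∀ x ∈ X, ¬ (openGraph ω).Reachable s x := fun ω => by
    simp only [hN, mem_setOf_eq, mem_singleton_iff, forall_eq, forall_mem_insert]
  -- `U ⊆ Y`
  have hUY : ∀ ω, ω ∈ U → (openGraph ω).Reachable s y := fun ω hω => h𝒰y _ hω
  -- the functional on clusters is the indicator of `U`
  have hFU : ∀ ω : BondConfig V, F (openEdgeCluster ω s) = U.indicator 1 ω := by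
    intro ω
    rw [hF ω]
    by_cases h : 𝒰 {v | (openGraph ω).Reachable s v}
    · rw [if_pos h, indicator_of_mem (show ω ∈ U from h), Pi.one_apply]
    · rw [if_neg h, indicator_of_notMem (show ω ∉ U from h)]
  have hI : ∀ S : Set (BondConfig V), ∫ ω in S, F (openEdgeCluster ω s) ∂μ = μ.real (S ∩ U) := by
    intro S
    simp_rw [hFU]
    exact TripodExchange.setIntegral_indicator_one_eq w S U
  -- set identities
  have sD' : D' = D \ Zv := avoid_insert_eq_diff' s z X
  have sD'Z : D' ∩ Zv = ∅ := by rw [sD']; exact Set.sdiff_inter_self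
  have sD'ZU : D' ∩ Zv ∩ U = ∅ := by rw [sD'Z, Set.empty_inter]
  have sA'W : A' ∩ D' ∩ Wv = ∅ := avoidY_insert_inter_conn_eq_empty' s y z X D'
  have sD'U : D' ∩ U = (D ∩ Yv ∩ U) \ Zv := by
    ext ω; simp only [mem_inter_iff, mem_sdiff, mD', mD, mY]
    constructor
    · rintro ⟨⟨hsz, hsX⟩, hu⟩; exact ⟨⟨⟨hsX, hUY ω hu⟩, hu⟩, hsz⟩
    · rintro ⟨⟨⟨hsX, -⟩, hu⟩, hsz⟩; exact ⟨⟨hsz, hsX⟩, hu⟩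
  have sD'YU : D' ∩ Yv ∩ U = (D ∩ Yv ∩ U) \ Zv := by
    ext ω; simp only [mem_inter_iff, mem_sdiff, mD', mD]; tauto
  have sDZU : D ∩ Zv ∩ U = D ∩ Yv ∩ U ∩ Zv := by
    ext ω; simp only [mem_inter_iff, mY]
    constructor
    · rintro ⟨⟨hd, hz⟩, hu⟩; exact ⟨⟨⟨hd, hUY ω hu⟩, hu⟩, hz⟩
    · rintro ⟨⟨⟨hd, -⟩, hu⟩, hz⟩; exact ⟨⟨hd, hz⟩, hu⟩
  have sD'Y : D' ∩ Yv = (D ∩ Yv) \ Zv := by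
    ext ω; simp only [mem_inter_iff, mem_sdiff, mD', mD]; tauto
  -- `T ∩ W ⊆ Zᶜ`: y↔z and s↔z would give s↔y
  have hTWZ : ∀ ω, ω ∈ A ∩ D ∩ Wv → ω ∉ Zv := by
    rintro ω ⟨⟨ha, -⟩, hw⟩ hz
    rw [mA] at ha
    exact ha.1 ((show (openGraph ω).Reachable y z from hw).trans (show (openGraph ω).Reachable s z from hz).symm)
  have sTdW : ((A ∩ D) \ Zv) ∩ Wv = A ∩ D ∩ Wv := by
    ext ω; simp only [mem_inter_iff, mem_sdiff]
    constructor
    · rintro ⟨⟨had, -⟩, hw⟩; exact ⟨had, hw⟩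
    · rintro ⟨had, hw⟩; exact ⟨⟨had, hTWZ ω ⟨had, hw⟩⟩, hw⟩
  have sT' : ((A ∩ D) \ Zv) \ Wv = A' ∩ D' := by
    ext ω; simp only [mem_inter_iff, mem_sdiff, mA, mD, mA', mD', mZ, mW]; tauto
  have sTzwZ : A ∩ D ∩ (Zv ∪ Wv) ∩ Zv = A ∩ D ∩ Zv := by
    ext ω; simp only [mem_inter_iff, mem_union]; tauto
  have sTzwW : (A ∩ D ∩ (Zv ∪ Wv)) \ Zv = A ∩ D ∩ Wv := by
    ext ω; simp only [mem_inter_iff, mem_union, mem_sdiff]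
    constructor
    · rintro ⟨⟨had, hzw⟩, hz⟩; exact ⟨had, hzw.resolve_left hz⟩
    · rintro ⟨had, hw⟩; exact ⟨⟨had, Or.inr hw⟩, hTWZ ω ⟨had, hw⟩⟩
  -- `E₁ = A₀ ∩ D` splits along `Y` into `D ∩ Y` and `T = A ∩ D`
  have sE₁Y : A₀ ∩ D ∩ Yv = D ∩ Yv := by
    ext ω; simp only [mem_inter_iff, mA₀, mD, mY]
    constructor
    · rintro ⟨⟨-, hd⟩, hy⟩; exact ⟨hd, hy⟩
    · rintro ⟨hd, hy⟩; exact ⟨⟨fun x hx hyx => hd x hx (hy.trans hyx), hd⟩, hy⟩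
  have sE₁N : (A₀ ∩ D) \ Yv = A ∩ D := by
    ext ω; simp only [mem_inter_iff, mem_sdiff, mA₀, mD, mA, mY]
    constructor
    · rintro ⟨⟨ha, hd⟩, hy⟩; exact ⟨⟨fun h => hy h.symm, ha⟩, hd⟩
    · rintro ⟨⟨hys, ha⟩, hd⟩; exact ⟨⟨ha, hd⟩, fun h => hys h.symm⟩
  have sE₁zY : A₀ ∩ D ∩ (Zv ∪ Wv) ∩ Yv = (D ∩ Yv) ∩ Zv := by
    ext ω; simp only [mem_inter_iff, mem_union, mA₀, mD, mY, mZ, mW]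
    constructor
    · rintro ⟨⟨⟨-, hd⟩, hzw⟩, hy⟩; exact ⟨⟨hd, hy⟩, hzw.elim id fun hyz => hy.trans hyz⟩
    · rintro ⟨⟨hd, hy⟩, hz⟩; exact ⟨⟨⟨fun x hx hyx => hd x hx (hy.trans hyx), hd⟩, Or.inl hz⟩, hy⟩
  have sE₁zN : (A₀ ∩ D ∩ (Zv ∪ Wv)) \ Yv = A ∩ D ∩ (Zv ∪ Wv) := by
    ext ω; simp only [mem_inter_iff, mem_union, mem_sdiff, mA₀, mD, mA, mY]
    constructor
    · rintro ⟨⟨⟨ha, hd⟩, hzw⟩, hy⟩; exact ⟨⟨⟨fun h => hy h.symm, ha⟩, hd⟩, hzw⟩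
    · rintro ⟨⟨⟨hys, ha⟩, hd⟩, hzw⟩; exact ⟨⟨⟨ha, hd⟩, hzw⟩, fun h => hys h.symm⟩
  -- `N = D ∖ Y` splits along `Gy = {y ↔ X}` into `T` and `N ∩ Gy`
  have sDN : D \ Yv = N := by
    ext ω; simp only [mem_sdiff, mD, mN, mY]; tauto
  have sNT : N \ Gy = A ∩ D := by
    ext ω; simp only [mem_sdiff, mN, mGy, mem_inter_iff, mA, mD, not_exists, not_and]
    constructor
    · rintro ⟨⟨hsy, hsX⟩, hg⟩; exact ⟨⟨fun h => hsy h.symm, hg⟩, hsX⟩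
    · rintro ⟨⟨hys, hg⟩, hsX⟩; exact ⟨⟨fun h => hys h.symm, hsX⟩, hg⟩
  have sNZT : (N ∩ Zv) \ Gy = A ∩ D ∩ Zv := by
    rw [Set.sdiff_eq, inter_right_comm, ← Set.sdiff_eq, sNT]
  have sNZG : N ∩ (Zv ∩ Gy) = N ∩ Zv ∩ Gy := (inter_assoc N Zv Gy).symm
  have sNGZ : N ∩ Gy ∩ Zv = N ∩ Zv ∩ Gy := inter_right_comm N Gy Zv
  have sDZN : (D ∩ Zv) \ Yv = N ∩ Zv := by
    rw [Set.sdiff_eq, inter_right_comm, ← Set.sdiff_eq, sDN]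
  have sDYZu : (D ∩ Yv ∩ Zv) \ U = ((D ∩ Yv) \ U) ∩ Zv := by
    ext ω; simp only [mem_inter_iff, mem_sdiff]; tauto
  have sDYUZ : D ∩ Yv ∩ U ∩ Zv = (D ∩ Yv ∩ Zv) ∩ U := inter_right_comm (D ∩ Yv) U Zv
  -- the nine atoms
  set b := μ.real (D ∩ Yv ∩ U ∩ Zv) with hb
  set aZ := μ.real ((D ∩ Yv ∩ U) \ Zv) with haZ
  set yZu := μ.real (((D ∩ Yv) \ U) ∩ Zv) with hyZu
  set yzu := μ.real (((D ∩ Yv) \ U) \ Zv) with hyzu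
  set TZ := μ.real (A ∩ D ∩ Zv) with hTZ
  set tw := μ.real (A ∩ D ∩ Wv) with htw
  set tp := μ.real (A' ∩ D') with htp
  set q1 := μ.real (N ∩ Zv ∩ Gy) with hq1
  set Q23 := μ.real ((N ∩ Gy) \ Zv) with hQ23
  have h0 : ∀ S : Set (BondConfig V), 0 ≤ μ.real S := fun _ => measureReal_nonneg
  -- two-block splits
  have r1 : μ.real (D ∩ Yv ∩ U) = b + aZ := by
    have h := measureReal_inter_add_sdiff (μ := μ) (s := D ∩ Yv ∩ U) (hmeas Zv); linarith
  have r2 : μ.real ((D ∩ Yv) \ U) = yZu + yzu := by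
    have h := measureReal_inter_add_sdiff (μ := μ) (s := (D ∩ Yv) \ U) (hmeas Zv); linarith
  have r3 : μ.real (D ∩ Yv) = b + aZ + (yZu + yzu) := by
    have h := measureReal_inter_add_sdiff (μ := μ) (s := D ∩ Yv) (hmeas U); rw [r1, r2] at h; linarith
  have r4 : μ.real (D ∩ Yv ∩ Zv) = b + yZu := by
    have h := measureReal_inter_add_sdiff (μ := μ) (s := D ∩ Yv ∩ Zv) (hmeas U)
    rw [← sDYUZ, sDYZu] at h; linarith
  have r5 : μ.real ((A ∩ D) \ Zv) = tw + tp := by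
    have h := measureReal_inter_add_sdiff (μ := μ) (s := (A ∩ D) \ Zv) (hmeas Wv)
    rw [sTdW, sT'] at h; linarith
  have r6 : μ.real (A ∩ D) = TZ + (tw + tp) := by
    have h := measureReal_inter_add_sdiff (μ := μ) (s := A ∩ D) (hmeas Zv); rw [r5] at h; linarith
  have r7 : μ.real (A ∩ D ∩ (Zv ∪ Wv)) = TZ + tw := by
    have h := measureReal_inter_add_sdiff (μ := μ) (s := A ∩ D ∩ (Zv ∪ Wv)) (hmeas Zv)
    rw [sTzwZ, sTzwW] at h; linarith
  have r8 : μ.real (A₀ ∩ D) = (b + aZ + (yZu + yzu)) + (TZ + (tw + tp)) := by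
    have h := measureReal_inter_add_sdiff (μ := μ) (s := A₀ ∩ D) (hmeas Yv)
    rw [sE₁Y, sE₁N, r3, r6] at h; linarith
  have r9 : μ.real (A₀ ∩ D ∩ (Zv ∪ Wv)) = (b + yZu) + (TZ + tw) := by
    have h := measureReal_inter_add_sdiff (μ := μ) (s := A₀ ∩ D ∩ (Zv ∪ Wv)) (hmeas Yv)
    rw [sE₁zY, sE₁zN, r4, r7] at h; linarith
  have r10 : μ.real (N ∩ Gy) = q1 + Q23 := by
    have h := measureReal_inter_add_sdiff (μ := μ) (s := N ∩ Gy) (hmeas Zv); rw [sNGZ] at h; linarith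
  have r11 : μ.real N = (q1 + Q23) + (TZ + (tw + tp)) := by
    have h := measureReal_inter_add_sdiff (μ := μ) (s := N) (hmeas Gy); rw [sNT, r10, r6] at h; linarith
  have r12 : μ.real (N ∩ Zv) = q1 + TZ := by
    have h := measureReal_inter_add_sdiff (μ := μ) (s := N ∩ Zv) (hmeas Gy); rw [sNZT] at h; linarith
  have r13 : μ.real D = (b + aZ + (yZu + yzu)) + ((q1 + Q23) + (TZ + (tw + tp))) := by
    have h := measureReal_inter_add_sdiff (μ := μ) (s := D) (hmeas Yv); rw [sDN, r3, r11] at h; linarith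
  have r14 : μ.real (D ∩ Zv) = (b + yZu) + (q1 + TZ) := by
    have h := measureReal_inter_add_sdiff (μ := μ) (s := D ∩ Zv) (hmeas Yv)
    rw [inter_right_comm, sDZN, r4, r12] at h; linarith
  have r15 : μ.real D' = aZ + yzu + tw + tp + Q23 := by
    have h := measureReal_inter_add_sdiff (μ := μ) (s := D) (hmeas Zv); rw [← sD', r13, r14] at h; linarith
  have r16 : μ.real (D' ∩ Yv) = aZ + yzu := by
    have h := measureReal_inter_add_sdiff (μ := μ) (s := D ∩ Yv) (hmeas Zv); rw [← sD'Y, r3, r4] at h; linarith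
  have r17 : μ.real (D' ∩ U) = aZ := by rw [sD'U]
  have r18 : μ.real (D' ∩ Yv ∩ U) = aZ := by rw [sD'YU]
  have r19 : μ.real (D ∩ Zv ∩ U) = b := by rw [sDZU]
  have r20 : μ.real (D' ∩ Zv ∩ U) = 0 := by rw [sD'ZU, measureReal_empty]
  have r21 : μ.real (D' ∩ Zv) = 0 := by rw [sD'Z, measureReal_empty]
  have r22 : μ.real (A' ∩ D' ∩ Wv) = 0 := by rw [sA'W, measureReal_empty]
  -- (G5) BHK Theorem 1.4 with sets: `{s}` repelled from `{y} ∪ X`; `1{s↔z}` versus `1{y↔X}`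
  set G₂ : Set (Sym2 V) → ℝ := fun C => if ∃ x ∈ X, (openGraph C).Reachable y x then 1 else 0 with hG₂
  have hG₂m : Monotone G₂ := by
    refine TripodExchange.predIndicator_monotone ?_
    rintro C C' hCC' ⟨x, hx, hr⟩
    exact ⟨x, hx, hr.mono (openGraph_mono hCC')⟩
  have hF₂ω : ∀ ω : BondConfig V, connIndicatorFn s z (⋃ a ∈ ({s} : Set V), openEdgeCluster ω a) = Zv.indicator 1 ω := by
    intro ω
    have : (⋃ a ∈ ({s} : Set V), openEdgeCluster ω a) = openEdgeCluster ω s := by ext e; simp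
    rw [this, connIndicatorFn_openEdgeCluster]
  have hG₂ω : ∀ ω : BondConfig V, G₂ (⋃ t ∈ insert y X, openEdgeCluster ω t) = Gy.indicator 1 ω := by
    intro ω
    have hiff : (∃ x ∈ X, (openGraph (⋃ t ∈ insert y X, openEdgeCluster ω t)).Reachable y x) ↔
        ∃ x ∈ X, (openGraph ω).Reachable y x := by
      constructor
      · rintro ⟨x, hx, hr⟩
        exact ⟨x, hx, (KNSep.reachable_iff_cluster ω (insert y X) (mem_insert y X) x).2 hr⟩
      · rintro ⟨x, hx, hr⟩
        exact ⟨x, hx, (KNSep.reachable_iff_cluster ω (insert y X) (mem_insert y X) x).1 hr⟩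
    simp only [hG₂, hiff]
    exact TwoSetConditionalAssociation.predIndicator_eq_indicator (fun ω' => ∃ x ∈ X, (openGraph ω').Reachable y x) ω
  have hR0 := BHK2006_twoSetConditionalAssociation.negCorrelation w ({s} : Set V) (insert y X) (connIndicatorFn s z) G₂
    (monotone_connIndicatorFn s z) hG₂m
  simp only [hF₂ω, hG₂ω] at hR0
  change μ.real N * (∫ ω in N, Zv.indicator 1 ω * Gy.indicator 1 ω ∂μ) ≤
    (∫ ω in N, Zv.indicator 1 ω ∂μ) * ∫ ω in N, Gy.indicator 1 ω ∂μ at hR0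
  rw [TripodExchange.setIntegral_indicator_one_eq, TripodExchange.setIntegral_indicator_one_eq,
    TripodExchange.setIntegral_indicator_mul_indicator_eq, sNZG, r11, r12, r10] at hR0
  change ((q1 + Q23) + (TZ + (tw + tp))) * q1 ≤ (q1 + TZ) * (q1 + Q23) at hR0
  -- the exchange hypotheses in atoms
  change μ.real (D ∩ Yv ∩ U) * tw ≤ μ.real ((A ∩ D) \ Zv) * μ.real (D ∩ Yv ∩ U ∩ Zv) at hG1
  rw [r1, r5] at hG1
  change μ.real (A₀ ∩ D ∩ (Zv ∪ Wv)) * μ.real (D ∩ Yv ∩ U) ≤ μ.real (A₀ ∩ D) * μ.real (D ∩ Yv ∩ U ∩ Zv) at hG2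
  rw [r9, r1, r8] at hG2
  change μ.real (A ∩ D ∩ (Zv ∪ Wv)) * μ.real (D ∩ Yv ∩ U) ≤ μ.real (A ∩ D) * μ.real (D ∩ Yv ∩ U ∩ Zv) at hG3
  rw [r7, r1, r6] at hG3
  -- the member in atoms
  unfold polMargin
  rw [hI, hI, hI, hI, hI, hI, r22, r21, r20, r19, r17, r18, r15, r14, r16]
  have e := markerPinned_algebra b aZ yZu yzu TZ tw tp q1 Q23
  have p1 : 0 ≤ tw * ((tw + tp) * b - (b + aZ) * tw) := mul_nonneg (h0 _) (by linarith)
  have p2 : 0 ≤ tp * ((b + aZ + yZu + yzu + TZ + tw + tp) * b - (b + yZu + TZ + tw) * (b + aZ)) :=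
    mul_nonneg (h0 _) (by linarith)
  have p3 : 0 ≤ Q23 * ((TZ + tw + tp) * b - (TZ + tw) * (b + aZ)) := mul_nonneg (h0 _) (by linarith)
  have p4 : 0 ≤ aZ * (TZ * (TZ + tw + tp + q1 + Q23) - (TZ + q1) * (TZ + tw + tp)) := mul_nonneg (h0 _) (by linarith)
  have p5 : 0 ≤ aZ * tw * q1 := mul_nonneg (mul_nonneg (h0 _) (h0 _)) (h0 _)
  linarith [e, p1, p2, p3, p4, p5]

end Consts

end Summit.CriticalPhenomena.PercolationContinuityZ3.Theorems

end
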